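import Literature.AlgebraicGeometry.Resolution.BirationalFlatteningCharts
import Literature.AlgebraicGeometry.Resolution.StrictTransformFlatteningBaseReduction
import Literature.AlgebraicGeometry.Resolution.StrictTransformTargetLocality
import Literature.AlgebraicGeometry.Resolution.StrictTransformTransport
import HarnessLib

/-!
# Birational flattening, II: Stacks 081R for an isomorphism over `U`, and Stacks 081S

Topic: `Literature/AlgebraicGeometry/Resolution`. Second half (after `BirationalFlatteningCharts`)
of an elementary proof of the special case of Raynaud–Gruson flattening (Stacks, Tag 081R; the
named fact `Stacks081R` of `StrictTransformFlattening.lean`) in which `φ : X → S` is an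
ISOMORPHISM over `U = S ∖ V(K)`, `K` an effective Cartier divisor
(`exists_isBlowup_flat_lfp_of_isIso`), and, from it, an UNCONDITIONAL proof of Stacks, Tag 081S
(`stacks081S`; compare `stacks081S_of_stacks081R`, which assumed `Stacks081R`): a separated
morphism of finite type which is an isomorphism over a quasi-compact open `U` of a quasi-compact
quasi-separated scheme becomes an open immersion after a `U`-admissible blowing up. This is the
only input from flattening in the Stacks Project's proof of Nagata's compactification theorem
(Tag 0F41 = Conrad 2007, Thm. 4.1).

**The proof of `exists_isBlowup_flat_lfp_of_isIso`** (two levels of blowing ups; Conrad 2007,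
proof of Thm. 2.4, Cases 1–2, reorganised around strict transforms and the universal property of
blowing ups):

* the conclusion is local on the base over a finite affine open cover on whose members `K` is
  principal, `K|_T = (u)` (`exists_isBlowup_flat_lfp_of_finset_affineOpens_base`: extend the
  centres from `T` to `S`, Stacks 080N, and blow up their product), and local on the source over
  a finite affine open cover (`exists_isBlowup_flat_lfp_of_finset_affineOpens_source`: one
  blowing up dominating the finitely many given ones); an affine piece `Y → T` is then an open
  immersion over `D(u)`, i.e. an isomorphism over an open `V ⊆ D(u)` over which all of
  `Y|_{D(u)}` lies (`exists_le_isIso_morphismRestrict`);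
* **level 1** (`exists_isBlowup_flat_lfp_of_isIso_affine`): for `ψ : Y → S` affine, finitely
  many `D(h) ⊆ V` cover `ψ⁻¹D(u)`, whence a relation `u^M = Σ β_h h` in `Γ(Y, 𝒪_Y)`
  (`exists_pow_eq_sum_of_preimage_basicOpen_le`); blow up `(u^M, h) · (u)`; then every point of
  the strict transform `Y¹ → S¹` lies over an open `W ⊆ S¹` with `W ∩ b⁻¹D(u) ⊆ b⁻¹D(h) ⊆ b⁻¹V`
  for some `h` (`exists_open_inf_preimage_basicOpen_le`: where the exceptional ideal is
  generated by `b♯u^M` rather than by some `b♯h`, the relation read on `Y¹` — on which `b♯u` is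
  regular — shows that some `b♯h / τ` is a unit anyway), so that over such `W` the strict
  transform is an isomorphism off the exceptional divisor;
* **level 2** (`exists_isBlowup_flat_lfp_piece`): over a good affine `C ⊆ S¹` on which the
  exceptional divisor is principal, `(e)`, the piece `ψ¹⁻¹C → C` is affine, of finite type, an
  isomorphism over `D(e)` with schematically dense preimage, so the chart lemma
  (`isOpenImmersion_blowupStrictTransformMap_of_relations`) applies: after blowing up
  `(e^N, g_x) · (e)` (centre extended from `C` to `S¹`, Stacks 080N) its strict transform is an
  open immersion, in particular flat and locally of finite presentation;
* the two levels are composed by Stacks 080L (`IsBlowup.exists_isBlowup_comp_admissible`) and the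
  strict transforms along the composite identified by `blowupStrictTransformMap_comp_base_iff`
  and `blowupStrictTransformMap_comp_iff_of_isClosedImmersion`.

**`stacks081S`** is then the proof of `stacks081S_of_stacks081R` verbatim with Raynaud–Gruson's
theorem replaced by `exists_isBlowup_flat_lfp_of_isIso` (its only use there was for a morphism
which is an isomorphism over the complement of an effective Cartier divisor).

## References

* The Stacks Project, Tags 081R, 081S, 081M, 080L, 080N, 080D, 0F41. [StacksProject]
* B. Conrad, *Deligne's notes on Nagata compactifications*, J. Ramanujan Math. Soc. 22 (2007),
  proof of Thm. 2.4 (Cases 1–2), Thm. 2.11, Thm. 4.1. [Conrad2007]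
* M. Raynaud, L. Gruson, *Critères de platitude et de projectivité*, Invent. Math. 13 (1971),
  Première partie, Thm. 5.2.2, 5.7. [RaynaudGruson1971]
-/

noncomputable section

-- Mathlib's pull-back API is stated through `abbrev`s over `limit`; as in Mathlib's own
-- algebraic-geometry files we let `simp`/unification see through them.
set_option backward.isDefEq.respectTransparency false

open CategoryTheory CategoryTheory.Limits AlgebraicGeometry TopologicalSpace

namespace Literature.AlgebraicGeometry.Resolution

universe u

/-! ## Level 1: the strict transform avoids the closure of `b⁻¹(D(u) ∖ V)` -/

section ClosureExclusion

variable {Y S T : Scheme.{u}} [IsAffine S] (ψ : Y ⟶ S) (u : Γ(S, ⊤)) (b : T ⟶ S)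

/-- **Exclusion, level 1.** Let `ψ : Y → S` (`S` affine) satisfy `u^M = Σ_{h ∈ H} β_h h` in
`Γ(Y, 𝒪_Y)` (e.g. `Y` affine and `ψ⁻¹D(u) ⊆ ⋃_{h ∈ H} ψ⁻¹D(h)`), and let `b : T → S` be such
that `b⁻¹L 𝒪_T` (`V(L) = V(u)`) and `b⁻¹I 𝒪_T`, `I = (u^M, h : h ∈ H)`, are effective Cartier
divisors. Then every point of the strict transform `Y'` of `Y` along `b` lies over an open
`W ⊆ T` with `W ∩ b⁻¹D(u) ⊆ b⁻¹D(h)` for some `h ∈ H`: near the image point write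
`b⁻¹I 𝒪_T(W) = (τ)`, `b♯u^M = v₀τ`, `b♯h = v_hτ`, `1 = w₀v₀ + Σ w_hv_h`; on `D(v_h)`,
`b♯h = v_hτ` does not vanish wherever `b♯u` does not; and if `v₀` does not vanish at the image
point then on `Y'` (where `b♯u` is regular) the relation gives `1 = ν Σ β_h v_h`, so some `v_h`
does not vanish there either. [cite: Conrad2007, proof of Thm. 2.4, Cases 1–2]
-/
theorem exists_open_inf_preimage_basicOpen_le (H : Finset Γ(S, ⊤)) (M : ℕ)
    (β : Γ(S, ⊤) → Γ(Y, ⊤)) (hrel : ψ.appTop u ^ M = ∑ h ∈ H, β h * ψ.appTop h)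
    (L : S.IdealSheafData) (hL : centreCompl L = S.basicOpen u)
    (hLb : IsEffectiveCartier (L.comap b))
    (hIb : IsEffectiveCartier ((Scheme.IdealSheafData.ofIdealTop
      (Ideal.span (insert (u ^ M) (H : Set Γ(S, ⊤))))).comap b))
    (y : blowupStrictTransform ψ b L) :
    ∃ W : T.Opens, blowupStrictTransformMap ψ b L y ∈ W ∧
      ∃ h ∈ H, W ⊓ b ⁻¹ᵁ S.basicOpen u ≤ b ⁻¹ᵁ S.basicOpen h := by
  classical
  set q := blowupStrictTransformMap ψ b L with hq
  set stι := blowupStrictTransformι ψ b L with hstι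
  set G := Scheme.IdealSheafData.ofIdealTop
    (Ideal.span (insert (u ^ M) (H : Set Γ(S, ⊤)))) with hG
  set t := q y with ht
  obtain ⟨W, htW, τ, hτ, hGW⟩ := hIb t
  set gens : Finset Γ(S, ⊤) := insert (u ^ M) H with hgens
  set t' : Finset Γ(T, W) := gens.image (b.appLE ⊤ W le_top) with ht'
  have hgens' : (insert (u ^ M) (H : Set Γ(S, ⊤))) = (↑gens : Set Γ(S, ⊤)) := by
    rw [hgens, Finset.coe_insert]
  have hGW' : (G.comap b).ideal W = Ideal.span (↑t' : Set Γ(T, W)) := by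
    rw [ideal_comap_of_le b G ⟨⊤, isAffineOpen_top S⟩ W le_top, hG, hgens',
      Scheme.IdealSheafData.ofIdealTop_ideal, Ideal.map_map, Ideal.map_span, ht', Finset.coe_image]
    congr 2
    ext a
    change (S.presheaf.map _ ≫ b.appLE ⊤ W le_top) a = _
    rw [Scheme.Hom.map_appLE]
  rw [hGW'] at hGW
  obtain ⟨f, -, hf⟩ := Submodule.mem_span_finset.mp
    (show τ ∈ Ideal.span (↑t' : Set Γ(T, W)) from hGW ▸ Ideal.mem_span_singleton_self τ)
  have hv : ∀ e ∈ t', ∃ v : Γ(T, W), v * τ = e := fun e he =>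
    Ideal.mem_span_singleton'.mp (hGW.symm ▸ Ideal.subset_span he)
  choose! v hv using hv
  have hsum : ∑ e ∈ t', f e * v e = 1 := by
    have h1 : (∑ e ∈ t', f e * v e) * τ = τ := by
      rw [Finset.sum_mul]
      conv_rhs => rw [← hf]
      refine Finset.sum_congr rfl fun e he => ?_
      rw [mul_assoc, hv e he, smul_eq_mul]
    have h2 : (∑ e ∈ t', f e * v e - 1) * τ = 0 := by rw [sub_mul, one_mul, h1, sub_self]
    exact sub_eq_zero.mp ((mem_nonZeroDivisors_iff_right.mp hτ) _ h2)
  have hmemU : b.appLE ⊤ W le_top (u ^ M) ∈ t' :=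
    Finset.mem_image_of_mem _ (Finset.mem_insert_self _ _)
  have hmemH : ∀ h ∈ H, b.appLE ⊤ W le_top h ∈ t' := fun h hh =>
    Finset.mem_image_of_mem _ (Finset.mem_insert_of_mem hh)
  set v₀ := v (b.appLE ⊤ W le_top (u ^ M)) with hv₀
  -- `D(τ) ⊇ W ∩ b⁻¹D(u)`, as `b♯u^M = v₀ τ`
  have hDτ : (W : T.Opens) ⊓ b ⁻¹ᵁ S.basicOpen u ≤ T.basicOpen τ := by
    intro x hx
    have hxu : x ∈ T.basicOpen (b.appLE ⊤ W le_top u) := by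
      rw [Scheme.basicOpen_appLE]; exact hx
    have hxuM : x ∈ T.basicOpen (b.appLE ⊤ W le_top (u ^ M)) := by
      rw [T.mem_basicOpen _ x hx.1] at hxu ⊢
      rw [map_pow, map_pow]
      exact hxu.pow M
    rw [← hv _ hmemU, Scheme.basicOpen_mul] at hxuM
    exact hxuM.2
  -- KEY: some `v_h`, `h ∈ H`, does not vanish at `t`
  have key : ∃ h ∈ H, t ∈ T.basicOpen (v (b.appLE ⊤ W le_top h)) := by
    obtain ⟨e, he, hte⟩ := exists_mem_basicOpen_of_sum_mul_eq_one t' f v hsum htW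
    rw [ht', Finset.mem_image] at he
    obtain ⟨x, hx, rfl⟩ := he
    rw [hgens, Finset.mem_insert] at hx
    rcases hx with rfl | hxH
    swap
    · exact ⟨x, hxH, hte⟩
    -- `t ∈ D(v₀)`: argue on `Y'` near `y`
    set W₁ : T.Opens := T.basicOpen v₀ with hW₁
    have hW₁W : W₁ ≤ W := T.basicOpen_le _
    set Q : (blowupStrictTransform ψ b L).Opens := q ⁻¹ᵁ W₁ with hQ
    have hyQ : y ∈ Q := hte
    have hQW : Q ≤ q ⁻¹ᵁ W := fun z hz => hW₁W hz
    set ρ : Γ(T, W) →+* Γ(blowupStrictTransform ψ b L, Q) := (q.appLE W Q hQW).hom with hρ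
    set π : Γ(Y, ⊤) →+* Γ(blowupStrictTransform ψ b L, Q) :=
      ((stι ≫ pullback.fst ψ b).appLE ⊤ Q le_top).hom with hπ
    have hR : (stι ≫ pullback.fst ψ b) ≫ ψ = q ≫ b := by
      rw [Category.assoc, pullback.condition, ← Category.assoc, hstι, blowupStrictTransformι_snd]
    have hπρ : ∀ a, π (ψ.appTop a) = ρ (b.appLE ⊤ W le_top a) := fun a => by
      simp only [hπ, hρ]
      change (ψ.appTop ≫ (stι ≫ pullback.fst ψ b).appLE ⊤ Q le_top) a =
        (b.appLE ⊤ W le_top ≫ q.appLE W Q hQW) a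
      rw [Scheme.Hom.appLE_comp_appLE, Scheme.Hom.appTop, Scheme.Hom.app_eq_appLE]
      change (ψ.appLE ⊤ (ψ ⁻¹ᵁ ⊤) le_rfl ≫ (stι ≫ pullback.fst ψ b).appLE (ψ ⁻¹ᵁ ⊤) Q le_top) a = _
      rw [Scheme.Hom.appLE_comp_appLE]
      exact congrArg (fun k : blowupStrictTransform ψ b L ⟶ S => k.appLE ⊤ Q le_top a) hR
    have hμ : ρ (b.appLE ⊤ W le_top u) ∈ nonZeroDivisors _ := by
      obtain ⟨hqc, hsd⟩ := quasiCompact_and_isSchemeTheoreticallyDominant_ι_preimage ψ b L hLb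
      haveI := hqc
      haveI := hsd
      refine mem_nonZeroDivisors_of_inf_le_basicOpen (q ⁻¹ᵁ (b ⁻¹ᵁ centreCompl L)) Q _
        fun z hz => ?_
      rw [hρ]
      change z ∈ (blowupStrictTransform ψ b L).basicOpen (q.appLE W Q hQW (b.appLE ⊤ W le_top u))
      rw [Scheme.basicOpen_appLE, Scheme.basicOpen_appLE, ← hL]
      exact ⟨hz.1, hQW hz.1, hz.2⟩
    have hunit : IsUnit (ρ v₀) := by
      refine isUnit_of_le_basicOpen _ fun z hz => ?_
      rw [hρ]
      change z ∈ (blowupStrictTransform ψ b L).basicOpen (q.appLE W Q hQW v₀)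
      rw [Scheme.basicOpen_appLE]
      exact ⟨hz, hz⟩
    obtain ⟨ν, hν⟩ := hunit.exists_left_inv
    -- `μ^M = Σ π(β_h) ρ(v_h) ρ(τ)` and `μ^M = ρ(v₀) ρ(τ)`
    have r1 : ρ (b.appLE ⊤ W le_top u) ^ M =
        (∑ h ∈ H, π (β h) * ρ (v (b.appLE ⊤ W le_top h))) * ρ τ := by
      rw [← hπρ, ← map_pow, hrel, map_sum, Finset.sum_mul]
      refine Finset.sum_congr rfl fun h hh => ?_
      rw [map_mul, hπρ]
      conv_lhs => rw [← hv _ (hmemH h hh), map_mul]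
      rw [mul_assoc]
    have r2 : ρ (b.appLE ⊤ W le_top u) ^ M = ρ v₀ * ρ τ := by
      rw [← map_pow, ← map_pow, ← hv _ hmemU, map_mul]
    have hτ' : ρ τ = ν * ρ (b.appLE ⊤ W le_top u) ^ M := by
      rw [r2, ← mul_assoc, hν, one_mul]
    have h4 : (1 - ν * ∑ h ∈ H, π (β h) * ρ (v (b.appLE ⊤ W le_top h))) *
        ρ (b.appLE ⊤ W le_top u) ^ M = 0 := by
      have h5 : ρ (b.appLE ⊤ W le_top u) ^ M =
          ν * (∑ h ∈ H, π (β h) * ρ (v (b.appLE ⊤ W le_top h))) *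
            ρ (b.appLE ⊤ W le_top u) ^ M := by
        conv_lhs => rw [r1, hτ']
        ring
      rw [sub_mul, one_mul, ← h5, sub_self]
    have h6 : ∑ h ∈ H, (ν * π (β h)) * ρ (v (b.appLE ⊤ W le_top h)) = 1 := by
      have h7 := sub_eq_zero.mp ((mem_nonZeroDivisors_iff_right.mp (pow_mem hμ M)) _ h4)
      rw [Finset.mul_sum] at h7
      rw [h7]
      exact Finset.sum_congr rfl fun h _ => by ring
    obtain ⟨h, hh, hyh⟩ := exists_mem_basicOpen_of_sum_mul_eq_one H _ _ h6 hyQ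
    refine ⟨h, hh, ?_⟩
    rw [hρ] at hyh
    change y ∈ (blowupStrictTransform ψ b L).basicOpen (q.appLE W Q hQW _) at hyh
    rw [Scheme.basicOpen_appLE] at hyh
    exact hyh.2
  -- conclude with `W' = D(v_h)`
  obtain ⟨h, hh, hth⟩ := key
  refine ⟨T.basicOpen (v (b.appLE ⊤ W le_top h)), hth, h, hh, fun x hx => ?_⟩
  have hxW : x ∈ (W : T.Opens) := T.basicOpen_le _ hx.1
  have hxτ : x ∈ T.basicOpen τ := hDτ ⟨hxW, hx.2⟩
  have hxh : x ∈ T.basicOpen (b.appLE ⊤ W le_top h) := by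
    rw [← hv _ (hmemH h hh), Scheme.basicOpen_mul]
    exact ⟨hx.1, hxτ⟩
  rw [Scheme.basicOpen_appLE] at hxh
  exact hxh.2

end ClosureExclusion
/-! ## Level 1: the relation `u^M = Σ β_h h` on an affine piece -/

section Relation

variable {Y S : Scheme.{u}} [IsAffine Y] [IsAffine S] (ψ : Y ⟶ S) (u : Γ(S, ⊤)) (V : S.Opens)

/-- **The level-1 relation.** Let `ψ : Y → S` be a morphism of affine schemes and `V ⊆ S` an
open over which the part of `Y` over `D(u)` lies. Then there are finitely many `h ∈ Γ(S, 𝒪_S)`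
with `D(h) ⊆ V` and a relation `u^M = Σ_h β_h h` (`M ≥ 1`) in `Γ(Y, 𝒪_Y)`: finitely many
`ψ⁻¹D(h)`, `D(h) ⊆ V`, cover the quasi-compact `ψ⁻¹D(u) = D(ψ♯u)`, so the `ψ♯h` generate the
unit ideal of `Γ(Y, D(ψ♯u)) = Γ(Y, 𝒪_Y)[1/ψ♯u]`. [folklore] -/
theorem exists_pow_eq_sum_of_preimage_basicOpen_le (hψV : ψ ⁻¹ᵁ S.basicOpen u ≤ ψ ⁻¹ᵁ V) :
    ∃ (H : Finset Γ(S, ⊤)) (M : ℕ) (β : Γ(S, ⊤) → Γ(Y, ⊤)), 0 < M ∧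
      (∀ h ∈ H, S.basicOpen h ≤ V) ∧ ψ.appTop u ^ M = ∑ h ∈ H, β h * ψ.appTop h := by
  classical
  -- finitely many `ψ⁻¹D(h)`, `D(h) ⊆ V`, cover `D(ψ♯u)`
  set fu := ψ.appTop u with hfu
  have hYu : Y.basicOpen fu = ψ ⁻¹ᵁ S.basicOpen u := (Scheme.preimage_basicOpen_top ψ u).symm
  have hcpt : IsCompact ((Y.basicOpen fu : Y.Opens) : Set Y) :=
    ((isAffineOpen_top Y).basicOpen fu).isCompact
  let ι := {h : Γ(S, ⊤) // S.basicOpen h ≤ V}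
  have hcov : ((Y.basicOpen fu : Y.Opens) : Set Y) ⊆ ⋃ i : ι, ((ψ ⁻¹ᵁ S.basicOpen i.1 : Y.Opens) : Set Y) := by
    intro y hy
    rw [hYu] at hy
    have hyV : ψ y ∈ V := hψV hy
    obtain ⟨h, hhV, hyh⟩ := (isAffineOpen_top S).exists_basicOpen_le ⟨ψ y, hyV⟩ (Opens.mem_top _)
    exact Set.mem_iUnion.mpr ⟨⟨h, hhV⟩, hyh⟩
  obtain ⟨t, ht⟩ := hcpt.elim_finite_subcover
    (fun i : ι => ((ψ ⁻¹ᵁ S.basicOpen i.1 : Y.Opens) : Set Y))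
    (fun i => (ψ ⁻¹ᵁ S.basicOpen i.1).isOpen) hcov
  set H : Finset Γ(S, ⊤) := t.image Subtype.val with hH
  have hHV : ∀ h ∈ H, S.basicOpen h ≤ V := fun h hh => by
    obtain ⟨i, -, rfl⟩ := Finset.mem_image.mp hh
    exact i.2
  -- the `ψ♯h|_{D(fu)}` generate the unit ideal of `Γ(Y, D(fu))`
  set r : Γ(S, ⊤) → Γ(Y, Y.basicOpen fu) := fun h =>
    Y.presheaf.map (homOfLE (Y.basicOpen_le fu)).op (ψ.appTop h) with hr
  have hspan : Ideal.span (r '' (H : Set Γ(S, ⊤))) = ⊤ := by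
    rw [← ((isAffineOpen_top Y).basicOpen fu).self_le_iSup_basicOpen_iff]
    intro y hy
    obtain ⟨i, hi⟩ := Set.mem_iUnion.mp (ht hy)
    obtain ⟨hit, hyi⟩ := Set.mem_iUnion.mp hi
    refine Opens.mem_iSup.mpr ⟨⟨r i.1, ⟨i.1, Finset.mem_image_of_mem _ hit, rfl⟩⟩, ?_⟩
    change y ∈ Y.basicOpen (Y.presheaf.map _ (ψ.appTop i.1))
    rw [Scheme.basicOpen_res]
    exact ⟨hy, (Scheme.preimage_basicOpen_top ψ i.1) ▸ hyi⟩
  -- write `1 = Σ a_h r(h)` and clear denominators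
  have h1 : (1 : Γ(Y, Y.basicOpen fu)) ∈ Ideal.span (r '' (H : Set Γ(S, ⊤))) := hspan ▸ Submodule.mem_top
  obtain ⟨t₀, ht₀, a, ha⟩ := (Submodule.mem_span_image_iff_exists_fun _).mp h1
  haveI := (isAffineOpen_top Y).isLocalization_basicOpen fu
  obtain ⟨d, hd⟩ := IsLocalization.exist_integer_multiples_of_finset (Submonoid.powers fu)
    (Finset.univ.image a)
  have hγ : ∀ i : t₀, ∃ γ : Γ(Y, ⊤), algebraMap Γ(Y, ⊤) Γ(Y, Y.basicOpen fu) γ = (d : Γ(Y, ⊤)) • a i :=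
    fun i => hd (a i) (Finset.mem_image_of_mem a (Finset.mem_univ i))
  choose γ hγ using hγ
  obtain ⟨m, hm⟩ := (Submonoid.mem_powers_iff _ _).mp d.2
  -- `fu^m = Σ γ_i ψ♯i` in the localisation, hence `fu^(k+m) = Σ fu^k γ_i ψ♯i` in `Γ(Y, 𝒪_Y)`
  have hloc : algebraMap Γ(Y, ⊤) Γ(Y, Y.basicOpen fu) (fu ^ m) =
      algebraMap Γ(Y, ⊤) Γ(Y, Y.basicOpen fu) (∑ i : t₀, γ i * ψ.appTop i) := by
    rw [hm, map_sum]
    have h2 : algebraMap Γ(Y, ⊤) Γ(Y, Y.basicOpen fu) d = (d : Γ(Y, ⊤)) • (1 : Γ(Y, Y.basicOpen fu)) := by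
      rw [Algebra.smul_def, mul_one]
    rw [h2, ← ha, Finset.smul_sum]
    refine Finset.sum_congr rfl fun i _ => ?_
    rw [map_mul, hγ, smul_eq_mul, Algebra.smul_def, Algebra.smul_def, mul_assoc]
    rfl
  obtain ⟨⟨_, k, rfl⟩, hk⟩ := (IsLocalization.eq_iff_exists (Submonoid.powers fu) _).mp hloc
  dsimp only at hk
  refine ⟨t₀, k + m + 1, fun h => if hh : h ∈ t₀ then fu * fu ^ k * γ ⟨h, hh⟩ else 0,
    Nat.succ_pos _, fun h hh => hHV h (ht₀ hh), ?_⟩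
  rw [pow_succ, pow_add, mul_comm _ fu, hk, Finset.mul_sum, Finset.mul_sum, ← Finset.sum_coe_sort t₀]
  refine Finset.sum_congr rfl fun i _ => ?_
  have hβ : (fun h => if hh : h ∈ t₀ then fu * fu ^ k * γ ⟨h, hh⟩ else 0) (i : Γ(S, ⊤)) =
      fu * fu ^ k * γ i := by
    simp only [Finset.coe_mem, ↓reduceDIte, Subtype.coe_eta]
  rw [hβ]
  ring

end Relation
/-! ## Small lemmas on restrictions and strict transforms -/

section Small

/-- The restriction of the inclusion of an open `Z ⊆ X` over an open `O ⊆ Z` is an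
isomorphism. [folklore] -/
theorem isIso_ι_morphismRestrict_of_le {X : Scheme.{u}} {Z O : X.Opens} (h : O ≤ Z) :
    IsIso (Z.ι ∣_ O) := by
  haveI : Epi (Z.ι ∣_ O).base := by
    rw [TopCat.epi_iff_surjective]
    rintro ⟨x, hx⟩
    refine ⟨⟨⟨x, h hx⟩, hx⟩, Subtype.ext ?_⟩
    rw [morphismRestrict_base_coe]
    rfl
  exact IsOpenImmersion.isIso _

variable {X S S' : Scheme.{u}} (f : X ⟶ S) (b : S' ⟶ S) (I : S.IdealSheafData)

/-- **The strict transform of an `X → S` landing in an open `S₀ ⊆ S`, along `S'|_{b⁻¹S₀} → S`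
versus along `b : S' → S`.** If a property `P` of morphisms (respecting isomorphisms and stable
under post-composition with open immersions) holds for the strict transform of `f` along
`b⁻¹S₀ → S' → S`, it holds for the strict transform along `b`: the latter lies over `b⁻¹S₀`,
where it is the former (`isPullback_blowupStrictTransform_over`). [cite: StacksProject, Tag 080C] -/
theorem blowupStrictTransformMap_of_range_subset {S₀ : Scheme.{u}} (i : S₀ ⟶ S) [IsOpenImmersion i]
    (hf : Set.range f ⊆ Set.range i) (hE : IsEffectiveCartier (I.comap b))
    (P : MorphismProperty Scheme.{u}) [P.RespectsIso]
    (hP : ∀ {A B C : Scheme.{u}} (l : A ⟶ B) (j : B ⟶ C) [IsOpenImmersion j], P l → P (l ≫ j))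
    (h : P (blowupStrictTransformMap f (pullback.fst b i ≫ b) I)) :
    P (blowupStrictTransformMap f b I) := by
  set j := pullback.fst b i with hj
  set K := ((pullback.snd f b) ⁻¹ᵁ (b ⁻¹ᵁ centreCompl I)).ι.ker with hK
  set g := K.subschemeι ≫ pullback.snd f b with hg
  change P g
  have sq := isPullback_blowupStrictTransform_over f b I j
  rw [← hK] at sq
  set top := (K.comapIso (strictTransformOverι f b j)).hom ≫
    pullback.snd (strictTransformOverι f b j) K.subschemeι with htop
  set left := (K.comap (strictTransformOverι f b j)).subschemeι ≫ pullback.snd f (j ≫ b) with hleft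
  change IsPullback top left g j at sq
  have hleftP : P left := by
    rw [hleft, hK, ← ker_blowupStrictTransformι_over f b I j hE]
    exact h
  -- `g` lands in `b⁻¹S₀ = range j`
  have hrange : Set.range g ⊆ Set.range j := by
    rintro _ ⟨x, rfl⟩
    rw [hj, Scheme.Pullback.range_fst]
    change b (g x) ∈ Set.range i
    have : (g ≫ b) x = (K.subschemeι ≫ pullback.fst f b ≫ f) x := by
      rw [hg, Category.assoc, ← pullback.condition]
    rw [← Scheme.Hom.comp_apply, this, Scheme.Hom.comp_apply, Scheme.Hom.comp_apply]
    exact hf ⟨_, rfl⟩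
  -- so `top` is an isomorphism
  haveI : IsOpenImmersion top := MorphismProperty.of_isPullback sq.flip inferInstance
  haveI : IsIso top := by
    haveI : Epi top.base := by
      rw [TopCat.epi_iff_surjective]
      intro x
      obtain ⟨s₀, hs₀⟩ := hrange ⟨x, rfl⟩
      obtain ⟨z, hz, -⟩ := Scheme.Pullback.exists_preimage_pullback x s₀ hs₀.symm
      refine ⟨sq.isoPullback.inv z, ?_⟩
      change (sq.isoPullback.inv ≫ top) z = x
      rw [IsPullback.isoPullback_inv_fst]
      exact hz
    exact IsOpenImmersion.isIso top
  -- `g = l ≫ j` with `left = top ≫ l`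
  set l := IsOpenImmersion.lift j g hrange with hl
  have hlj : l ≫ j = g := IsOpenImmersion.lift_fac _ _ _
  have hleft' : left = top ≫ l := by
    rw [← cancel_mono j, Category.assoc top l j, hlj]
    exact sq.w.symm
  rw [← hlj]
  refine hP l j ?_
  rw [← P.cancel_left_of_respectsIso top, ← hleft']
  exact hleftP

end Small
/-! ## Reductions: the conclusion is local on the source and on the base (finite-cover forms) -/

section Reductions

open Literature.AlgebraicGeometry.Limits

/-- **Locality on the source, finite-cover form** (cf. `exists_isBlowup_flat_lfp_of_forall_affineOpens_source`):
if finitely many affine opens `V ∈ t` cover `X` and for each of them a `U`-admissible blowing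
up of `S` in an ideal sheaf of finite type flattens the strict transform of `V → S`, then one
flattens the strict transform of `X → S`. [cite: StacksProject, Tag 081R (proof)] -/
theorem exists_isBlowup_flat_lfp_of_finset_affineOpens_source {X S : Scheme.{u}} (f : X ⟶ S)
    (U : S.Opens) (t : Finset X.affineOpens) (ht : (⊤ : X.Opens) ≤ ⨆ V ∈ t, (V : X.Opens))
    (h : ∀ V ∈ t, ∃ (I : S.IdealSheafData) (S' : Scheme.{u}) (b : S' ⟶ S),
      (∀ W : S.affineOpens, (I.ideal W).FG) ∧ Disjoint (U : Set S) (I.support : Set S) ∧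
      IsBlowup b I ∧ Flat (blowupStrictTransformMap ((V : X.Opens).ι ≫ f) b I) ∧
      LocallyOfFinitePresentation (blowupStrictTransformMap ((V : X.Opens).ι ≫ f) b I)) :
    ∃ (I : S.IdealSheafData) (S' : Scheme.{u}) (b : S' ⟶ S),
      (∀ W : S.affineOpens, (I.ideal W).FG) ∧ Disjoint (U : Set S) (I.support : Set S) ∧
      IsBlowup b I ∧ Flat (blowupStrictTransformMap f b I) ∧
      LocallyOfFinitePresentation (blowupStrictTransformMap f b I) := by
  classical
  have ht' : ⨆ V : t, (((V : X.affineOpens) : X.Opens)) = ⊤ :=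
    top_le_iff.mp (ht.trans (le_of_eq iSup_subtype'))
  choose I S₁ b₁ hIfg hIU hb₁ hflat₁ hlfp₁ using h
  obtain ⟨S', c, hc, hcfg, hcU, hdom⟩ :=
    IsBlowup.exists_isBlowup_prod_dominating U (fun V : t => b₁ V.1 V.2) (fun V : t => I V.1 V.2)
      (fun V => hb₁ V.1 V.2) (fun V => hIfg V.1 V.2) (fun V => hIU V.1 V.2)
  choose g hg _hgb _hgfg _hgU using hdom
  have hsupp : ∀ V : t, ((I V.1 V.2).support : Set S) ⊆ ((∏ W : t, I W.1 W.2).support : Set S) :=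
    fun V x hx => Scheme.IdealSheafData.support_antitone
      (finsetProd_le Finset.univ (fun W : t => I W.1 W.2) (Finset.mem_univ V)) hx
  have hE : IsEffectiveCartier ((∏ W : t, I W.1 W.2).comap c) := hc.isEffectiveCartier
  haveI : ∀ V : t, Flat (blowupStrictTransformMap (((V : X.affineOpens) : X.Opens).ι ≫ f) c
      (∏ W : t, I W.1 W.2)) := fun V =>
    haveI := hflat₁ V.1 V.2
    flat_blowupStrictTransformMap_of_dominating (Iᵢ := I V.1 V.2) (I := ∏ W : t, I W.1 W.2) (hg V)
      (hsupp V) hE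
  refine ⟨∏ V : t, I V.1 V.2, S', c, hcfg, hcU, hc, ?_, ?_⟩
  · exact blowupStrictTransformMap_of_iSup_eq_top f c (∏ V : t, I V.1 V.2) @Flat hE
      (fun V : t => ((V : X.affineOpens) : X.Opens)) ht' fun V => inferInstance
  · refine blowupStrictTransformMap_of_iSup_eq_top f c (∏ V : t, I V.1 V.2) @LocallyOfFinitePresentation
      hE (fun V : t => ((V : X.affineOpens) : X.Opens)) ht' fun V => ?_
    haveI := hflat₁ V.1 V.2
    haveI := hlfp₁ V.1 V.2
    exact locallyOfFinitePresentation_blowupStrictTransformMap_of_dominating (Iᵢ := I V.1 V.2)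
      (I := ∏ W : t, I W.1 W.2) (hg V) (hsupp V) hE

/-- **Locality on the base, finite-cover form** (cf. `exists_isBlowup_flat_lfp_of_forall_affineOpens_base`):
if finitely many affine opens `T ∈ t` cover `S` and over each of them the base change
`X_T → T` admits a `(U ∩ T)`-admissible blowing up flattening its strict transform, then
`X → S` admits a `U`-admissible blowing up flattening its strict transform.
[cite: StacksProject, Tag 0814 with Tag 081R (proof) and Tag 080N] -/
theorem exists_isBlowup_flat_lfp_of_finset_affineOpens_base {X S : Scheme.{u}} (f : X ⟶ S)
    [CompactSpace S] [QuasiSeparatedSpace S] (U : S.Opens) (hU : IsCompact (U : Set S))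
    (t : Finset S.affineOpens) (ht : (⊤ : S.Opens) ≤ ⨆ T ∈ t, (T : S.Opens))
    (h : ∀ T ∈ t, ∃ (I : (T : Scheme.{u}).IdealSheafData) (T' : Scheme.{u})
      (b : T' ⟶ T),
      (∀ W : (T : Scheme.{u}).affineOpens, (I.ideal W).FG) ∧
      Disjoint (((T : S.Opens).ι ⁻¹ᵁ U : (T : Scheme.{u}).Opens) : Set T) (I.support : Set T) ∧
      IsBlowup b I ∧
      Flat (blowupStrictTransformMap (pullback.snd f (T : S.Opens).ι) b I) ∧
      LocallyOfFinitePresentation (blowupStrictTransformMap (pullback.snd f (T : S.Opens).ι) b I)) :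
    ∃ (I : S.IdealSheafData) (S' : Scheme.{u}) (b : S' ⟶ S),
      (∀ W : S.affineOpens, (I.ideal W).FG) ∧ Disjoint (U : Set S) (I.support : Set S) ∧
      IsBlowup b I ∧ Flat (blowupStrictTransformMap f b I) ∧
      LocallyOfFinitePresentation (blowupStrictTransformMap f b I) := by
  classical
  have ht' : ⨆ T : t, (((T : S.affineOpens) : S.Opens)) = ⊤ :=
    top_le_iff.mp (ht.trans (le_of_eq iSup_subtype'))
  choose I S₁ b₁ hIfg hIU hb₁ hflat₁ hlfp₁ using h
  -- extend the centres `I T` to `U`-admissible centres `G T` on `S`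
  have hG : ∀ T : t, ∃ G : S.IdealSheafData, (∀ W : S.affineOpens, (G.ideal W).FG) ∧
      G.comap ((T : S.affineOpens) : S.Opens).ι = I T.1 T.2 ∧
      Disjoint (U : Set S) (G.support : Set S) := fun T =>
    exists_fg_comap_ι_eq_of_disjoint U hU ((T : S.affineOpens) : S.Opens) T.1.2.isCompact
      (I T.1 T.2) (hIfg T.1 T.2) (hIU T.1 T.2)
  choose G hGfg hGI hGU using hG
  obtain ⟨S', c, hc⟩ := exists_isBlowup S (∏ T : t, G T)
  have hE : IsEffectiveCartier ((∏ T : t, G T).comap c) := hc.isEffectiveCartier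
  have hCfg : ∀ W : S.affineOpens, ((∏ T : t, G T).ideal W).FG :=
    fg_ideal_finsetProd _ _ fun T _ => hGfg T
  have hCU : Disjoint (U : Set S) ((∏ T : t, G T).support : Set S) := by
    rw [support_finsetProd]
    exact Set.disjoint_iUnion₂_right.mpr fun T _ => hGU T
  have hpiece : ∀ T : t,
      Flat (blowupStrictTransformMap (pullback.snd f ((T : S.affineOpens) : S.Opens).ι)
        (pullback.snd c ((T : S.affineOpens) : S.Opens).ι)
        ((∏ T' : t, G T').comap ((T : S.affineOpens) : S.Opens).ι)) ∧
      LocallyOfFinitePresentation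
        (blowupStrictTransformMap (pullback.snd f ((T : S.affineOpens) : S.Opens).ι)
          (pullback.snd c ((T : S.affineOpens) : S.Opens).ι)
          ((∏ T' : t, G T').comap ((T : S.affineOpens) : S.Opens).ι)) := by
    intro T
    have hrest : (∏ T' : t, G T').comap ((T : S.affineOpens) : S.Opens).ι =
        I T.1 T.2 * (∏ T' ∈ Finset.univ.erase T, G T').comap ((T : S.affineOpens) : S.Opens).ι := by
      rw [← Finset.mul_prod_erase Finset.univ (fun T' : t => G T') (Finset.mem_univ T), comap_mul,
        hGI]
    have hcT : IsBlowup (pullback.snd c ((T : S.affineOpens) : S.Opens).ι)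
        ((∏ T' : t, G T').comap ((T : S.affineOpens) : S.Opens).ι) := by
      rw [← pullbackRestrictIsoRestrict_hom_morphismRestrict]
      exact (hc.restrict _).iso_comp (pullbackRestrictIsoRestrict c _)
    obtain ⟨Z, c', hc'⟩ := exists_isBlowup (S₁ T.1 T.2)
      (((∏ T' ∈ Finset.univ.erase T, G T').comap ((T : S.affineOpens) : S.Opens).ι).comap (b₁ T.1 T.2))
    have hcomp : IsBlowup (c' ≫ b₁ T.1 T.2)
        ((∏ T' : t, G T').comap ((T : S.affineOpens) : S.Opens).ι) := by
      rw [hrest]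
      exact (hb₁ T.1 T.2).comp hc'
    obtain ⟨e, he, -⟩ := hcT.unique hcomp
    have hcomm : (e.hom ≫ c') ≫ b₁ T.1 T.2 = pullback.snd c ((T : S.affineOpens) : S.Opens).ι := by
      rw [Category.assoc, he]
    have hsupp : ((I T.1 T.2).support : Set (T : S.affineOpens)) ⊆
        ((∏ T' : t, G T').comap ((T : S.affineOpens) : S.Opens).ι).support := by
      refine Scheme.IdealSheafData.support_antitone ?_
      rw [← hGI T]
      exact Scheme.IdealSheafData.comap_mono _
        (finsetProd_le Finset.univ (fun T' : t => G T') (Finset.mem_univ T))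
    haveI := hflat₁ T.1 T.2
    haveI := hlfp₁ T.1 T.2
    exact ⟨flat_blowupStrictTransformMap_of_dominating (Iᵢ := I T.1 T.2) (I := _) hcomm hsupp
        hcT.isEffectiveCartier,
      locallyOfFinitePresentation_blowupStrictTransformMap_of_dominating (Iᵢ := I T.1 T.2) (I := _)
        hcomm hsupp hcT.isEffectiveCartier⟩
  refine ⟨∏ T : t, G T, S', c, hCfg, hCU, hc, ?_, ?_⟩
  · exact blowupStrictTransformMap_of_openCover_base f c _ @Flat hE
      (S.openCoverOfIsOpenCover (fun T : t => ((T : S.affineOpens) : S.Opens)) ht')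
      fun T => (hpiece T).1
  · exact blowupStrictTransformMap_of_openCover_base f c _ @LocallyOfFinitePresentation hE
      (S.openCoverOfIsOpenCover (fun T : t => ((T : S.affineOpens) : S.Opens)) ht')
      fun T => (hpiece T).2

end Reductions
/-! ## Assembly, step 1: the level-2 pieces -/

section Pieces

open Literature.AlgebraicGeometry.Limits

/-- Support of the ideal sheaf generated by global sections containing a power of `u` misses
`D(u)`. [folklore] -/
theorem disjoint_basicOpen_support_ofIdealTop {S : Scheme.{u}} (u : Γ(S, ⊤)) {J : Ideal Γ(S, ⊤)}
    {N : ℕ} (hN : u ^ N ∈ J) :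
    Disjoint ((S.basicOpen u : S.Opens) : Set S)
      ((Scheme.IdealSheafData.ofIdealTop J).support : Set S) := by
  rw [Scheme.IdealSheafData.coe_support_ofIdealTop, Set.disjoint_left]
  intro x hx hx'
  have h1 : x ∈ S.zeroLocus {u ^ N} := S.zeroLocus_mono (Set.singleton_subset_iff.mpr hN) hx'
  rw [Scheme.zeroLocus_singleton] at h1
  apply h1
  change x ∈ S.basicOpen u at hx
  change x ∈ S.basicOpen (u ^ N)
  rw [S.mem_basicOpen_top] at hx ⊢
  rw [map_pow]
  exact hx.pow N

/-- The ideal sheaf generated by a finitely generated ideal of global sections is of finite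
type. [folklore] -/
theorem fg_ideal_ofIdealTop {S : Scheme.{u}} {J : Ideal Γ(S, ⊤)} (hJ : J.FG) (W : S.affineOpens) :
    ((Scheme.IdealSheafData.ofIdealTop J).ideal W).FG := by
  rw [Scheme.IdealSheafData.ofIdealTop_ideal]
  exact hJ.map _

/-- A quasi-compact open of a compact scheme is compact. [folklore] -/
theorem isCompact_of_quasiCompact_ι {X : Scheme.{u}} [CompactSpace X] (O : X.Opens)
    [QuasiCompact O.ι] : IsCompact (O : Set X) := by
  haveI : CompactSpace O := QuasiCompact.compactSpace_of_compactSpace O.ι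
  rw [← Scheme.Opens.range_ι O]
  exact isCompact_range O.ι.continuous

/-- **The level-2 piece.** Let `ψ¹ : Y¹ → S¹` be affine and locally of finite type, `E` an
effective Cartier divisor of the quasi-compact quasi-separated `S¹` with `ψ¹⁻¹(S¹ ∖ E)`
quasi-compact and schematically dense in `Y¹`, and `C ⊆ S¹` an affine open on which `E` is
principal and over whose part off `E` the morphism `ψ¹` is an isomorphism. Then a
`(S¹ ∖ E)`-admissible blowing up of `S¹` in an ideal sheaf of finite type flattens the strict
transform of the piece `ψ¹⁻¹C → S¹` (which even becomes an open immersion): the chart lemma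
(`isOpenImmersion_blowupStrictTransformMap_of_relations`) for `ψ¹⁻¹C → C`, its centre extended
from `C` to `S¹` (Stacks 080N) and multiplied by `E`, transported back from the base change to
`C` (`blowupStrictTransformMap_baseChange_iff`, `blowupStrictTransformMap_of_range_subset`).
[cite: StacksProject, Tag 081R (proof); Conrad2007, proof of Thm. 2.4, Cases 1–2] -/
theorem exists_isBlowup_flat_lfp_piece {Y S : Scheme.{u}} [CompactSpace S] [QuasiSeparatedSpace S]
    (ψ : Y ⟶ S) [IsAffineHom ψ] [LocallyOfFiniteType ψ] {E : S.IdealSheafData}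
    (hE : IsEffectiveCartier E) [QuasiCompact (ψ ⁻¹ᵁ centreCompl E).ι]
    [IsSchemeTheoreticallyDominant (ψ ⁻¹ᵁ centreCompl E).ι]
    (C : S.affineOpens) (e : Γ(S, C)) (hEC : E.ideal C = Ideal.span {e})
    [IsIso (ψ ∣_ ((C : S.Opens) ⊓ centreCompl E))] :
    ∃ (I : S.IdealSheafData) (S' : Scheme.{u}) (b : S' ⟶ S),
      (∀ W : S.affineOpens, (I.ideal W).FG) ∧
      Disjoint ((centreCompl E : S.Opens) : Set S) (I.support : Set S) ∧ IsBlowup b I ∧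
      Flat (blowupStrictTransformMap ((ψ ⁻¹ᵁ (C : S.Opens)).ι ≫ ψ) b I) ∧
      LocallyOfFinitePresentation (blowupStrictTransformMap ((ψ ⁻¹ᵁ (C : S.Opens)).ι ≫ ψ) b I) := by
  classical
  haveI : IsAffine (C : S.Opens) := C.2
  set Z : Y.Opens := ψ ⁻¹ᵁ (C : S.Opens) with hZ
  haveI : IsAffine Z := C.2.preimage ψ
  -- `Z → S` as `(ψ|_C) ≫ C ↪ S`
  set f' : (Z : Scheme.{u}) ⟶ S := (ψ ∣_ (C : S.Opens)) ≫ (C : S.Opens).ι with hf'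
  have hf'Z : f' = Z.ι ≫ ψ := morphismRestrict_ι _ _
  -- the base change `ζ : Z ×_S C → C` (source `≅ Z`, affine)
  set ζ := pullback.snd f' (C : S.Opens).ι with hζ
  haveI : IsIso (pullback.fst f' (C : S.Opens).ι) := by
    rw [hf']; infer_instance
  haveI : IsAffine (pullback f' (C : S.Opens).ι) := IsAffine.of_isIso (pullback.fst f' (C : S.Opens).ι)
  -- `u_C`, with `D(u_C) = C ∩ (S ∖ E)` pulled back to `C`
  set uC : Γ((C : S.Opens), ⊤) :=
    (C : S.Opens).ι.appLE C ⊤ (Scheme.Opens.ι_preimage_self (C : S.Opens)).ge e with huC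
  have hCe : (C : S.Opens) ⊓ centreCompl E = S.basicOpen e :=
    Opens.ext (by rw [Opens.coe_inf]; exact inter_centreCompl_eq_basicOpen C e hEC)
  have hDu : (C : Scheme.{u}).basicOpen uC = (C : S.Opens).ι ⁻¹ᵁ centreCompl E := by
    rw [huC, Scheme.basicOpen_appLE, top_inf_eq, ← hCe]
    apply Opens.ext
    ext x
    exact ⟨fun hx => hx.2, fun hx => ⟨x.2, hx⟩⟩
  set O : S.Opens := (C : S.Opens) ⊓ centreCompl E with hO
  have hOC : (C : S.Opens).ι ⁻¹ᵁ O = (C : Scheme.{u}).basicOpen uC := by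
    rw [hDu, hO, Scheme.Hom.preimage_inf, Scheme.Opens.ι_preimage_self, top_inf_eq]
  -- `ζ` is an isomorphism over `D(u_C)`
  haveI : IsIso (f' ∣_ O) := by
    rw [hf'Z, morphismRestrict_comp]
    haveI : IsIso (Z.ι ∣_ ψ ⁻¹ᵁ O) := isIso_ι_morphismRestrict_of_le fun y hy => hy.1
    infer_instance
  haveI : IsIso (ζ ∣_ (C : Scheme.{u}).basicOpen uC) := by
    rw [← hOC, hζ]
    exact (MorphismProperty.isomorphisms.iff _).mp
      (pullback_snd_morphismRestrict_preimage (MorphismProperty.isomorphisms Scheme.{u}) f'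
        (C : S.Opens).ι O ((MorphismProperty.isomorphisms.iff _).mpr inferInstance))
  -- its part over `D(u_C)` is quasi-compact and schematically dense
  have hζD : ζ ⁻¹ᵁ (C : Scheme.{u}).basicOpen uC =
      (pullback.fst f' (C : S.Opens).ι) ⁻¹ᵁ (Z.ι ⁻¹ᵁ (ψ ⁻¹ᵁ centreCompl E)) := by
    rw [hDu, hζ, ← Scheme.Hom.comp_preimage, ← pullback.condition, Scheme.Hom.comp_preimage, hf'Z,
      Scheme.Hom.comp_preimage]
  haveI : QuasiCompact (Z.ι ⁻¹ᵁ (ψ ⁻¹ᵁ centreCompl E)).ι := quasiCompact_ι_preimage Z.ι _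
  haveI : IsSchemeTheoreticallyDominant (Z.ι ⁻¹ᵁ (ψ ⁻¹ᵁ centreCompl E)).ι :=
    isSchemeTheoreticallyDominant_ι_preimage Z.ι _
  haveI : QuasiCompact (ζ ⁻¹ᵁ (C : Scheme.{u}).basicOpen uC).ι := by
    rw [hζD]; exact quasiCompact_ι_preimage _ _
  haveI : IsSchemeTheoreticallyDominant (ζ ⁻¹ᵁ (C : Scheme.{u}).basicOpen uC).ι := by
    rw [hζD]; exact isSchemeTheoreticallyDominant_ι_preimage _ _
  -- generators and relations for `Γ(Z ×_S C) = Γ(Z)` over `Γ(C)`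
  obtain ⟨s, N, g, hgen, hN, hrel⟩ :=
    exists_finset_generators_relations ζ ⟨⊤, isAffineOpen_top _⟩ le_top uC
  have appLE_top_top : ∀ h, ζ.appLE ⊤ ⊤ h = ζ.appTop := fun h => by
    rw [Scheme.Hom.appTop, Scheme.Hom.app_eq_appLE]; rfl
  rw [appLE_top_top] at hgen
  have hrel' : ∀ x ∈ s, ζ.appTop uC ^ N * x = ζ.appTop (g x) := fun x hx => by
    have := hrel x hx
    rwa [appLE_top_top] at this
  -- the level-2 centre on `C`, extended to `S` and multiplied by `E`
  set J₀ : Ideal Γ((C : S.Opens), ⊤) := Ideal.span (insert (uC ^ N) (g '' (s : Set _))) with hJ₀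
  set J := Scheme.IdealSheafData.ofIdealTop J₀ with hJ
  have hJfg : ∀ W : (C : Scheme.{u}).affineOpens, (J.ideal W).FG := fun W =>
    fg_ideal_ofIdealTop (Submodule.fg_span ((s.finite_toSet.image g).insert _)) W
  have hJU : Disjoint (((C : S.Opens).ι ⁻¹ᵁ centreCompl E : (C : Scheme.{u}).Opens) :
      Set (C : Scheme.{u})) (J.support : Set (C : Scheme.{u})) := by
    rw [← hDu]
    exact disjoint_basicOpen_support_ofIdealTop uC (Ideal.subset_span (Set.mem_insert _ _))
  haveI : QuasiCompact (centreCompl E).ι := hE.quasiCompact_ι_centreCompl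
  have hUc : IsCompact ((centreCompl E : S.Opens) : Set S) := isCompact_of_quasiCompact_ι _
  obtain ⟨G, hGfg, hGJ, hGU⟩ :=
    exists_fg_comap_ι_eq_of_disjoint (centreCompl E) hUc (C : S.Opens) C.2.isCompact J hJfg hJU
  set I := G * E with hI
  obtain ⟨S', b, hb⟩ := exists_isBlowup S I
  have hIfg : ∀ W : S.affineOpens, (I.ideal W).FG := fun W => by
    rw [hI, Scheme.IdealSheafData.ideal_mul, Pi.mul_apply]
    exact (hGfg W).mul (hE.fg_ideal W)
  have hIsupp : (I.support : Set S) = ((centreCompl E : S.Opens) : Set S)ᶜ := by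
    rw [hI, Scheme.IdealSheafData.support_mul, TopologicalSpace.Closeds.coe_sup]
    change _ = ((E.support : Set S)ᶜ)ᶜ
    rw [compl_compl]
    exact Set.union_eq_right.mpr fun x hx => not_not.mp (hGU.subset_compl_left hx)
  have hIU : Disjoint ((centreCompl E : S.Opens) : Set S) (I.support : Set S) := by
    rw [hIsupp]; exact disjoint_compl_right
  have hccI : centreCompl I = centreCompl E := centreCompl_eq_of_support_eq hIsupp
  have hIb : IsEffectiveCartier (I.comap b) := hb.isEffectiveCartier
  have hGb : IsEffectiveCartier (G.comap b) := by
    have h := hIb; rw [hI, comap_mul] at h; exact h.of_mul_left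
  -- the base change `c : S' ×_S C → C` and the hypotheses of the chart lemma
  set c := pullback.snd b (C : S.Opens).ι with hc
  set L := I.comap (C : S.Opens).ι with hL
  have hccL : centreCompl L = (C : Scheme.{u}).basicOpen uC := by
    rw [hL, ← preimage_centreCompl, hccI, hDu]
  have hcond : c ≫ (C : S.Opens).ι = pullback.fst b (C : S.Opens).ι ≫ b := pullback.condition.symm
  have hLc : IsEffectiveCartier (L.comap c) := by
    rw [hL, ← Scheme.IdealSheafData.comap_comp, hcond, Scheme.IdealSheafData.comap_comp]
    exact hIb.comap_of_isOpenImmersion _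
  have hJc : IsEffectiveCartier ((Scheme.IdealSheafData.ofIdealTop
      (Ideal.span (insert (uC ^ N) (g '' (s : Set _))))).comap c) := by
    rw [← hJ₀, ← hJ, ← hGJ, ← Scheme.IdealSheafData.comap_comp, hcond,
      Scheme.IdealSheafData.comap_comp]
    exact hGb.comap_of_isOpenImmersion _
  haveI : IsIso (b ∣_ centreCompl E) := hb.isIso_morphismRestrict hIU
  haveI : IsIso (c ∣_ (C : Scheme.{u}).basicOpen uC) := by
    rw [hDu, hc]
    exact (MorphismProperty.isomorphisms.iff _).mp
      (pullback_snd_morphismRestrict_preimage (MorphismProperty.isomorphisms Scheme.{u}) b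
        (C : S.Opens).ι (centreCompl E) ((MorphismProperty.isomorphisms.iff _).mpr inferInstance))
  -- THE CHART LEMMA
  have hopen : IsOpenImmersion (blowupStrictTransformMap ζ c L) :=
    isOpenImmersion_blowupStrictTransformMap_of_relations ζ uC c s N g hrel' hgen L hccL hLc hJc
  -- transport back to the strict transform of `Z → S` along `b`
  have hP : ∀ (P : MorphismProperty Scheme.{u}) [P.RespectsIso],
      (∀ {A B : Scheme.{u}} (l : A ⟶ B) [IsOpenImmersion l], P l) →
      (∀ {A B D : Scheme.{u}} (l : A ⟶ B) (j : B ⟶ D) [IsOpenImmersion j], P l → P (l ≫ j)) →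
      P (blowupStrictTransformMap ((ψ ⁻¹ᵁ (C : S.Opens)).ι ≫ ψ) b I) := by
    intro P _ hP1 hP2
    rw [← hZ, ← hf'Z]
    refine blowupStrictTransformMap_of_range_subset f' b I (C : S.Opens).ι ?_ hIb P hP2 ?_
    · rintro _ ⟨x, rfl⟩
      exact ⟨(ψ ∣_ (C : S.Opens)) x, rfl⟩
    · exact (blowupStrictTransformMap_baseChange_iff f' b I (C : S.Opens).ι P hIb).mp (hP1 _)
  refine ⟨I, S', b, hIfg, hIU, hb, ?_, ?_⟩
  · exact hP @Flat (fun l _ => inferInstance) (fun l j _ _ => inferInstance)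
  · exact hP @LocallyOfFinitePresentation (fun l _ => inferInstance) (fun l j _ _ => inferInstance)

end Pieces
/-! ## Assembly, step 2: an affine piece which is an isomorphism onto an open over `D(u)` -/

section Assembly

open Literature.AlgebraicGeometry.Limits

/-- **Birational flattening of an affine piece.** Let `ψ : Y → S` be a morphism of affine
schemes, locally of finite type, which over `D(u)` factors through an open `V ⊆ D(u)` over which
it is an isomorphism. Then there is a `D(u)`-admissible blowing up `b : S' → S`, in an ideal
sheaf of finite type, along which the strict transform of `Y` is flat and locally of finite
presentation over `S'` (indeed an open immersion). Two levels: first blow up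
`(u^M, h : h ∈ H) · (u)` where `D(h) ⊆ V` and `u^M = Σ β_h h` on `Y`
(`exists_pow_eq_sum_of_preimage_basicOpen_le`), after which the strict transform `Y¹ → S¹`
lands in the open `S¹°` where `b⁻¹D(u) ⊆ b⁻¹V` (`exists_open_inf_preimage_basicOpen_le`), over
which it is an isomorphism off the exceptional divisor; then cover the image by affine opens
`C ⊆ S¹°` on which the exceptional divisor is principal and flatten the pieces `ψ¹⁻¹C → S¹` by
the chart lemma (`exists_isBlowup_flat_lfp_piece`), combine them
(`exists_isBlowup_flat_lfp_of_finset_affineOpens_source`) and compose the two blowing ups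
(Stacks 080L). [cite: Conrad2007, proof of Thm. 2.4, Cases 1–2; StacksProject, Tag 081R (proof)] -/
theorem exists_isBlowup_flat_lfp_of_isIso_affine {Y S : Scheme.{u}} [IsAffine Y] [IsAffine S]
    (ψ : Y ⟶ S) [LocallyOfFiniteType ψ] (u : Γ(S, ⊤)) (V : S.Opens) (hV : V ≤ S.basicOpen u)
    [IsIso (ψ ∣_ V)] (hψV : ψ ⁻¹ᵁ S.basicOpen u ≤ ψ ⁻¹ᵁ V) :
    ∃ (I : S.IdealSheafData) (S' : Scheme.{u}) (b : S' ⟶ S),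
      (∀ W : S.affineOpens, (I.ideal W).FG) ∧
      Disjoint ((S.basicOpen u : S.Opens) : Set S) (I.support : Set S) ∧ IsBlowup b I ∧
      Flat (blowupStrictTransformMap ψ b I) ∧
      LocallyOfFinitePresentation (blowupStrictTransformMap ψ b I) := by
  classical
  /- Step 1: the relation and the level-1 centre -/
  obtain ⟨H, M, β, hM, hHV, hrel⟩ := exists_pow_eq_sum_of_preimage_basicOpen_le ψ u V hψV
  set I₁ := Scheme.IdealSheafData.ofIdealTop (Ideal.span (insert (u ^ M) (H : Set Γ(S, ⊤))))
    with hI₁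
  set K := Scheme.IdealSheafData.ofIdealTop (Ideal.span ({u} : Set Γ(S, ⊤))) with hK
  set L₁ := I₁ * K with hL₁
  have hKsupp : (K.support : Set S) = ((S.basicOpen u : S.Opens) : Set S)ᶜ := by
    rw [hK, Scheme.IdealSheafData.coe_support_ofIdealTop, Scheme.zeroLocus_span,
      Scheme.zeroLocus_singleton]
  have hI₁U : Disjoint ((S.basicOpen u : S.Opens) : Set S) (I₁.support : Set S) :=
    disjoint_basicOpen_support_ofIdealTop u (Ideal.subset_span (Set.mem_insert _ _))
  have hL₁supp : (L₁.support : Set S) = ((S.basicOpen u : S.Opens) : Set S)ᶜ := by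
    rw [hL₁, Scheme.IdealSheafData.support_mul, TopologicalSpace.Closeds.coe_sup, hKsupp]
    exact Set.union_eq_right.mpr hI₁U.subset_compl_left
  have hL₁U : Disjoint ((S.basicOpen u : S.Opens) : Set S) (L₁.support : Set S) := by
    rw [hL₁supp]; exact disjoint_compl_right
  have hccL₁ : centreCompl L₁ = S.basicOpen u := centreCompl_eq_of_support_eq hL₁supp
  have hI₁fg : ∀ W : S.affineOpens, (I₁.ideal W).FG := fun W =>
    fg_ideal_ofIdealTop (Submodule.fg_span (H.finite_toSet.insert _)) W
  have hKfg : ∀ W : S.affineOpens, (K.ideal W).FG := fun W =>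
    fg_ideal_ofIdealTop (Submodule.fg_span (Set.finite_singleton u)) W
  have hL₁fg : ∀ W : S.affineOpens, (L₁.ideal W).FG := fun W => by
    rw [hL₁, Scheme.IdealSheafData.ideal_mul, Pi.mul_apply]
    exact (hI₁fg W).mul (hKfg W)
  /- Step 2: the level-1 blowing up `b₁ : S₁ → S` and the strict transform `ψ₁ : Y₁ → S₁` -/
  obtain ⟨S₁, b₁, hb₁⟩ := exists_isBlowup S L₁
  have hE₁ : IsEffectiveCartier (L₁.comap b₁) := hb₁.isEffectiveCartier
  have hI₁b : IsEffectiveCartier (I₁.comap b₁) := by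
    have h := hE₁; rw [hL₁, comap_mul] at h; exact h.of_mul_left
  have hKb : IsEffectiveCartier (K.comap b₁) := by
    have h := hE₁; rw [hL₁, comap_mul] at h; exact h.of_mul_right
  haveI : IsProper b₁ := IsBlowup.isProper_of_fg hL₁fg hb₁
  haveI : CompactSpace S₁ := QuasiCompact.compactSpace_of_compactSpace b₁
  haveI : QuasiSeparatedSpace S₁ := quasiSeparatedSpace_of_quasiSeparated b₁
  have hccE₁ : centreCompl (L₁.comap b₁) = b₁ ⁻¹ᵁ S.basicOpen u := by
    rw [← preimage_centreCompl, hccL₁]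
  set ψ₁ := blowupStrictTransformMap ψ b₁ L₁ with hψ₁
  haveI : IsAffineHom (pullback.snd ψ b₁) := MorphismProperty.pullback_snd _ _ inferInstance
  haveI : IsAffineHom ψ₁ :=
    inferInstanceAs (IsAffineHom (blowupStrictTransformι ψ b₁ L₁ ≫ pullback.snd ψ b₁))
  haveI : LocallyOfFiniteType ψ₁ :=
    inferInstanceAs (LocallyOfFiniteType (blowupStrictTransformι ψ b₁ L₁ ≫ pullback.snd ψ b₁))
  haveI : CompactSpace (blowupStrictTransform ψ b₁ L₁) := QuasiCompact.compactSpace_of_compactSpace ψ₁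
  obtain ⟨hqc, hsd⟩ := quasiCompact_and_isSchemeTheoreticallyDominant_ι_preimage ψ b₁ L₁ hE₁
  rw [preimage_centreCompl] at hqc hsd
  haveI := hqc
  haveI := hsd
  haveI hisoV : IsIso (ψ₁ ∣_ b₁ ⁻¹ᵁ V) :=
    isIso_blowupStrictTransformMap_morphismRestrict_of_le ψ b₁ L₁ hE₁ (hccL₁ ▸ hV)
  /- Step 3: good affine opens around the points of the image of `ψ₁` -/
  have hgood : ∀ y : blowupStrictTransform ψ b₁ L₁, ∃ (C : S₁.affineOpens) (e : Γ(S₁, C)),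
      ψ₁ y ∈ (C : S₁.Opens) ∧ (L₁.comap b₁).ideal C = Ideal.span {e} ∧
      (C : S₁.Opens) ⊓ centreCompl (L₁.comap b₁) ≤ b₁ ⁻¹ᵁ V := by
    intro y
    obtain ⟨W, hyW, h, hh, hW⟩ :=
      exists_open_inf_preimage_basicOpen_le ψ u b₁ H M β hrel L₁ hccL₁ hE₁ hI₁b y
    obtain ⟨W', hyW', τ, hτ, hEW'⟩ := hE₁ (ψ₁ y)
    obtain ⟨r, hrle, hyr⟩ := W'.2.exists_basicOpen_le (V := (W' : S₁.Opens) ⊓ W) ⟨ψ₁ y, hyW', hyW⟩ hyW'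
    refine ⟨⟨S₁.basicOpen r, W'.2.basicOpen r⟩, S₁.presheaf.map (homOfLE (S₁.basicOpen_le r)).op τ,
      hyr, ideal_eq_span_map_of_le _ (S₁.basicOpen_le r) hEW', ?_⟩
    intro x hx
    have hx' : x ∈ W ⊓ b₁ ⁻¹ᵁ S.basicOpen u := ⟨(hrle hx.1).2, hccE₁.le hx.2⟩
    exact hHV h hh (hW hx')
  choose C e hyC hEC hCV using hgood
  have hisoC : ∀ y, IsIso (ψ₁ ∣_ ((C y : S₁.Opens) ⊓ centreCompl (L₁.comap b₁))) := fun y =>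
    Literature.AlgebraicGeometry.Morphisms.isIso_morphismRestrict_of_le ψ₁ (hCV y)
  -- a finite subcover of `Y₁` by the `ψ₁⁻¹C_y`
  obtain ⟨t₀, ht₀⟩ := isCompact_univ.elim_finite_subcover
    (fun y : blowupStrictTransform ψ b₁ L₁ => ((ψ₁ ⁻¹ᵁ (C y : S₁.Opens) : (blowupStrictTransform ψ b₁ L₁).Opens) :
      Set (blowupStrictTransform ψ b₁ L₁)))
    (fun y => (ψ₁ ⁻¹ᵁ (C y : S₁.Opens)).isOpen) (fun y _ => Set.mem_iUnion.mpr ⟨y, hyC y⟩)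
  let piece : blowupStrictTransform ψ b₁ L₁ → (blowupStrictTransform ψ b₁ L₁).affineOpens := fun y =>
    ⟨ψ₁ ⁻¹ᵁ (C y : S₁.Opens), (C y).2.preimage ψ₁⟩
  set t : Finset (blowupStrictTransform ψ b₁ L₁).affineOpens := t₀.image piece with ht
  have htcov : (⊤ : (blowupStrictTransform ψ b₁ L₁).Opens) ≤
      ⨆ W ∈ t, (W : (blowupStrictTransform ψ b₁ L₁).Opens) := by
    intro y _
    obtain ⟨y₀, hy₀⟩ := Set.mem_iUnion.mp (ht₀ (Set.mem_univ y))
    obtain ⟨hy₀t, hyy₀⟩ := Set.mem_iUnion.mp hy₀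
    exact Opens.mem_iSup.mpr ⟨piece y₀, Opens.mem_iSup.mpr ⟨Finset.mem_image_of_mem _ hy₀t, hyy₀⟩⟩
  /- Step 4: flatten the pieces (chart lemma) and combine -/
  obtain ⟨I₂, S₂, b₂, hI₂fg, hI₂U, hb₂, hflat₂, hlfp₂⟩ :=
    exists_isBlowup_flat_lfp_of_finset_affineOpens_source ψ₁ (centreCompl (L₁.comap b₁)) t htcov
      (fun W hW => by
        obtain ⟨y, -, rfl⟩ := Finset.mem_image.mp hW
        haveI := hisoC y
        exact exists_isBlowup_flat_lfp_piece ψ₁ hE₁ (C y) (e y) (hEC y))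
  /- Step 5: compose the two blowing ups (Stacks 080L) and identify the strict transforms -/
  -- enlarge the second centre by the exceptional divisor of the first
  set J := I₂ * L₁.comap b₁ with hJ
  have hbJ : IsBlowup b₂ J := hb₂.mul_of_isEffectiveCartier_comap (hE₁.comap_of_isBlowup hb₂)
  have hEJ : IsEffectiveCartier (J.comap b₂) := hbJ.isEffectiveCartier
  have hJfg : ∀ W : S₁.affineOpens, (J.ideal W).FG := fun W => by
    rw [hJ, Scheme.IdealSheafData.ideal_mul, Pi.mul_apply]
    exact (hI₂fg W).mul (hE₁.fg_ideal W)
  have hJsupp : (J.support : Set S₁) = ((centreCompl (L₁.comap b₁) : S₁.Opens) : Set S₁)ᶜ := by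
    rw [hJ, Scheme.IdealSheafData.support_mul, TopologicalSpace.Closeds.coe_sup]
    change _ = (((L₁.comap b₁).support : Set S₁)ᶜ)ᶜ
    rw [compl_compl]
    exact Set.union_eq_right.mpr fun x hx => not_not.mp (hI₂U.subset_compl_left hx)
  have hccJ : centreCompl J = centreCompl (L₁.comap b₁) := centreCompl_eq_of_support_eq hJsupp
  have hsupple : (I₂.support : Set S₁) ⊆ J.support := by
    rw [hJ, Scheme.IdealSheafData.support_mul, TopologicalSpace.Closeds.coe_sup]
    exact Set.subset_union_left
  haveI := hflat₂
  haveI := hlfp₂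
  haveI hflatJ : Flat (blowupStrictTransformMap ψ₁ b₂ J) :=
    flat_blowupStrictTransformMap_of_dominating I₂ J (Category.id_comp b₂) hsupple hEJ
  haveI hlfpJ : LocallyOfFinitePresentation (blowupStrictTransformMap ψ₁ b₂ J) :=
    locallyOfFinitePresentation_blowupStrictTransformMap_of_dominating I₂ J (Category.id_comp b₂)
      hsupple hEJ
  -- the composite is a `D(u)`-admissible blowing up (Stacks 080L), centre normalised by `K`
  have hU₁disj : Disjoint ((b₁ ⁻¹ᵁ S.basicOpen u : S₁.Opens) : Set S₁) (J.support : Set S₁) := by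
    rw [hJsupp, hccE₁]
    exact disjoint_compl_right
  obtain ⟨Q, hQfg, hQU, hbQ⟩ :=
    hb₁.exists_isBlowup_comp_admissible (S.basicOpen u) hL₁fg hL₁U hbJ hJfg hU₁disj
  have hKb' : IsEffectiveCartier (K.comap (b₂ ≫ b₁)) := by
    rw [Scheme.IdealSheafData.comap_comp]
    exact hKb.comap_of_isBlowup hb₂
  have hbQ' : IsBlowup (b₂ ≫ b₁) (Q * K) := hbQ.mul_of_isEffectiveCartier_comap hKb'
  have hQsupp : ((Q * K).support : Set S) = ((S.basicOpen u : S.Opens) : Set S)ᶜ := by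
    rw [Scheme.IdealSheafData.support_mul, TopologicalSpace.Closeds.coe_sup, hKsupp]
    exact Set.union_eq_right.mpr hQU.subset_compl_left
  have hccQ : centreCompl (Q * K) = S.basicOpen u := centreCompl_eq_of_support_eq hQsupp
  refine ⟨Q * K, S₂, b₂ ≫ b₁, fun W => ?_, by rw [hQsupp]; exact disjoint_compl_right, hbQ', ?_⟩
  · rw [Scheme.IdealSheafData.ideal_mul, Pi.mul_apply]
    exact (hQfg W).mul (hKfg W)
  -- transport flatness along the identifications of strict transforms
  haveI : QuasiCompact ((pullback.snd ψ (b₂ ≫ b₁)) ⁻¹ᵁ ((b₂ ≫ b₁) ⁻¹ᵁ centreCompl (Q * K))).ι := by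
    rw [preimage_centreCompl]
    exact quasiCompact_ι_preimage_centreCompl _ hbQ'.isEffectiveCartier
  have hO : b₂ ⁻¹ᵁ centreCompl J = (b₂ ≫ b₁) ⁻¹ᵁ centreCompl (Q * K) := by
    rw [hccQ, hccJ, hccE₁, Scheme.Hom.comp_preimage]
  haveI : IsIso (blowupStrictTransformι ψ b₁ L₁ ∣_ (pullback.snd ψ b₁) ⁻¹ᵁ centreCompl J) := by
    rw [hccJ, ← preimage_centreCompl]
    exact isIso_blowupStrictTransformι_morphismRestrict ψ b₁ L₁ hE₁
  have htrans : ∀ (P : MorphismProperty Scheme.{u}) [P.RespectsIso],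
      P (blowupStrictTransformMap ψ₁ b₂ J) → P (blowupStrictTransformMap ψ (b₂ ≫ b₁) (Q * K)) := by
    intro P _ hP
    rw [blowupStrictTransformMap_comp_base_iff ψ b₁ b₂ J (Q * K) P hO]
    exact (blowupStrictTransformMap_comp_iff_of_isClosedImmersion (blowupStrictTransformι ψ b₁ L₁)
      (pullback.snd ψ b₁) b₂ J P hEJ).mp hP
  exact ⟨htrans @Flat hflatJ, htrans @LocallyOfFinitePresentation hlfpJ⟩

end Assembly
/-! ## The global statement -/

section Global

open Literature.AlgebraicGeometry.Limits

/-- If `ψ|_D` is an open immersion, `ψ` is an isomorphism over its image `V ⊆ D`, and the part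
of `Y` over `D` lies over `V`. [folklore] -/
theorem exists_le_isIso_morphismRestrict {Y S : Scheme.{u}} (ψ : Y ⟶ S) (D : S.Opens)
    [IsOpenImmersion (ψ ∣_ D)] :
    ∃ V : S.Opens, V ≤ D ∧ IsIso (ψ ∣_ V) ∧ ψ ⁻¹ᵁ D ≤ ψ ⁻¹ᵁ V := by
  set g : ((ψ ⁻¹ᵁ D : Y.Opens) : Scheme.{u}) ⟶ S := (ψ ⁻¹ᵁ D).ι ≫ ψ with hg
  haveI : IsOpenImmersion g := by
    rw [hg, ← morphismRestrict_ι]; infer_instance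
  have hgz : ∀ z, g z = ψ z.1 := fun z => rfl
  set V : S.Opens := g.opensRange with hV
  have hVD : V ≤ D := by
    rintro _ ⟨z, rfl⟩; rw [hgz]; exact z.2
  have hDV : ψ ⁻¹ᵁ D ≤ ψ ⁻¹ᵁ V := fun y hy => ⟨⟨y, hy⟩, rfl⟩
  refine ⟨V, hVD, ?_, hDV⟩
  haveI : IsOpenImmersion (ψ ∣_ V) :=
    Literature.AlgebraicGeometry.Morphisms.of_morphismRestrict_of_le @IsOpenImmersion ψ hVD
      inferInstance
  haveI : Epi (ψ ∣_ V).base := by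
    rw [TopCat.epi_iff_surjective]
    rintro ⟨_, ⟨z, rfl⟩⟩
    refine ⟨⟨z.1, hDV z.2⟩, Subtype.ext ?_⟩
    rw [morphismRestrict_base_coe]
    rfl
  exact IsOpenImmersion.isIso _

/-- **Birational flattening = Raynaud–Gruson flattening (Stacks, Tag 081R) for a morphism which
is an isomorphism over `U`.** Let `S` be quasi-compact and quasi-separated, `U = S ∖ V(K)` the
complement of an effective Cartier divisor, and `φ : X → S` quasi-compact, locally of finite
type and an isomorphism over `U`. Then there is a `U`-admissible blowing up `b : S' → S`, in an
ideal sheaf of finite type, such that the strict transform of `X` along `b` (Stacks 080D) is flat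
and locally of finite presentation over `S'`. Proof: the statement is local on the base
(`exists_isBlowup_flat_lfp_of_finset_affineOpens_base`, over affine opens on which `K` is
principal) and on the source (`exists_isBlowup_flat_lfp_of_forall_affineOpens_source`); the
affine pieces are `exists_isBlowup_flat_lfp_of_isIso_affine`. No use is made of Raynaud–Gruson's
theorem (`Stacks081R`), nor of Nagata's quasi-domination theorem (Conrad 2007, Thm. 2.4) beyond
the algebra of its Case 1. [cite: StacksProject, Tag 081R; Conrad2007, Thm. 2.4 and Thm. 2.11] -/
theorem exists_isBlowup_flat_lfp_of_isIso {X S : Scheme.{u}} (φ : X ⟶ S) [CompactSpace S]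
    [QuasiSeparatedSpace S] [QuasiCompact φ] [LocallyOfFiniteType φ] (K : S.IdealSheafData)
    (hK : IsEffectiveCartier K) [IsIso (φ ∣_ centreCompl K)] :
    ∃ (I : S.IdealSheafData) (S' : Scheme.{u}) (b : S' ⟶ S),
      (∀ W : S.affineOpens, (I.ideal W).FG) ∧
      Disjoint ((centreCompl K : S.Opens) : Set S) (I.support : Set S) ∧
      IsBlowup b I ∧ Flat (blowupStrictTransformMap φ b I) ∧
      LocallyOfFinitePresentation (blowupStrictTransformMap φ b I) := by
  classical
  haveI : QuasiCompact (centreCompl K).ι := hK.quasiCompact_ι_centreCompl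
  have hUc : IsCompact ((centreCompl K : S.Opens) : Set S) := isCompact_of_quasiCompact_ι _
  have hK' := hK
  -- a finite affine cover of `S` on whose members `K` is principal
  choose W hxW f hf hKW using hK'
  obtain ⟨t₀, ht₀⟩ := isCompact_univ.elim_finite_subcover (fun x : S => ((W x : S.Opens) : Set S))
    (fun x => (W x : S.Opens).isOpen) (fun x _ => Set.mem_iUnion.mpr ⟨x, hxW x⟩)
  set t : Finset S.affineOpens := t₀.image W with ht
  have htcov : (⊤ : S.Opens) ≤ ⨆ T ∈ t, (T : S.Opens) := by
    intro y _
    obtain ⟨x, hx⟩ := Set.mem_iUnion.mp (ht₀ (Set.mem_univ y))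
    obtain ⟨hxt, hyx⟩ := Set.mem_iUnion.mp hx
    exact Opens.mem_iSup.mpr ⟨W x, Opens.mem_iSup.mpr ⟨Finset.mem_image_of_mem _ hxt, hyx⟩⟩
  refine exists_isBlowup_flat_lfp_of_finset_affineOpens_base φ (centreCompl K) hUc t htcov ?_
  intro T hT
  obtain ⟨x, -, rfl⟩ := Finset.mem_image.mp hT
  haveI : IsAffine (W x : S.Opens) := (W x).2
  -- `u_T`, with `D(u_T) = T ∩ (S ∖ V(K))` pulled back to `T = W x`
  set uT : Γ((W x : S.Opens), ⊤) :=
    (W x : S.Opens).ι.appLE (W x) ⊤ (Scheme.Opens.ι_preimage_self (W x : S.Opens)).ge (f x)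
    with huT
  have hCe : (W x : S.Opens) ⊓ centreCompl K = S.basicOpen (f x) :=
    Opens.ext (by rw [Opens.coe_inf]; exact inter_centreCompl_eq_basicOpen (W x) (f x) (hKW x))
  have hDu : (W x : Scheme.{u}).basicOpen uT = (W x : S.Opens).ι ⁻¹ᵁ centreCompl K := by
    rw [huT, Scheme.basicOpen_appLE, top_inf_eq, ← hCe]
    apply Opens.ext
    ext y
    exact ⟨fun hy => hy.2, fun hy => ⟨y.2, hy⟩⟩
  have hOC : (W x : S.Opens).ι ⁻¹ᵁ ((W x : S.Opens) ⊓ centreCompl K) =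
      (W x : Scheme.{u}).basicOpen uT := by
    rw [hDu, Scheme.Hom.preimage_inf, Scheme.Opens.ι_preimage_self, top_inf_eq]
  -- the base change `φ_T : X ×_S T → T`
  set φT := pullback.snd φ (W x : S.Opens).ι with hφT
  haveI : IsIso (φ ∣_ ((W x : S.Opens) ⊓ centreCompl K)) :=
    Literature.AlgebraicGeometry.Morphisms.isIso_morphismRestrict_of_le φ inf_le_right
  haveI : IsIso (φT ∣_ (W x : Scheme.{u}).basicOpen uT) := by
    rw [← hOC, hφT]
    exact (MorphismProperty.isomorphisms.iff _).mp
      (pullback_snd_morphismRestrict_preimage (MorphismProperty.isomorphisms Scheme.{u}) φ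
        (W x : S.Opens).ι _ ((MorphismProperty.isomorphisms.iff _).mpr inferInstance))
  haveI : QuasiCompact φT := MorphismProperty.pullback_snd _ _ inferInstance
  haveI : LocallyOfFiniteType φT := MorphismProperty.pullback_snd _ _ inferInstance
  haveI : CompactSpace ↑(pullback φ (W x : S.Opens).ι) := QuasiCompact.compactSpace_of_compactSpace φT
  rw [← hDu]
  -- locality on the source; the affine pieces are `exists_isBlowup_flat_lfp_of_isIso_affine`
  refine exists_isBlowup_flat_lfp_of_forall_affineOpens_source φT ((W x : Scheme.{u}).basicOpen uT)
    fun Yv => ?_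
  haveI : IsAffine (Yv : (pullback φ (W x : S.Opens).ι).Opens) := Yv.2
  haveI : IsOpenImmersion (((Yv : (pullback φ (W x : S.Opens).ι).Opens).ι ≫ φT) ∣_
      (W x : Scheme.{u}).basicOpen uT) := by
    rw [morphismRestrict_comp]; infer_instance
  obtain ⟨V, hV, hiso, hψV⟩ :=
    exists_le_isIso_morphismRestrict ((Yv : (pullback φ (W x : S.Opens).ι).Opens).ι ≫ φT)
      ((W x : Scheme.{u}).basicOpen uT)
  haveI := hiso
  exact exists_isBlowup_flat_lfp_of_isIso_affine _ uT V hV hψV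

end Global

/-! ## Stacks 081S, unconditionally -/

section S081

open Literature.AlgebraicGeometry.Limits

/-- **Stacks 081S.** Let `φ : X → S` be separated and of finite type, `S` quasi-compact and
quasi-separated, and `U ⊆ S` a quasi-compact open over which `φ` is an isomorphism. Then there
is a `U`-admissible blowing up `b : S' → S` — in an ideal sheaf `𝓠` of finite type with
`V(𝓠) = S ∖ U` — such that the strict transform `X' → S'` of `φ` (Stacks 080D) is an open
immersion. Proof as printed (and as in `stacks081S_of_stacks081R`): first blow up a finite type
ideal sheaf with support `S ∖ U` to make `U` the complement of an effective Cartier divisor,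
then flatten the strict transform by a `U`-admissible blowing up — here by the elementary
birational flattening `exists_isBlowup_flat_lfp_of_isIso` instead of Raynaud–Gruson's theorem
(Stacks 081R) — after which it is flat, locally of finite presentation and an isomorphism over a
schematically dense retrocompact open, hence an open immersion (Stacks 081M); finally compose
the two blowing ups (Stacks 080L). [cite: StacksProject, Tag 081S] -/
theorem stacks081S {X S : Scheme.{u}} (φ : X ⟶ S)
    [CompactSpace S] [QuasiSeparatedSpace S] [IsSeparated φ] [QuasiCompact φ]
    [LocallyOfFiniteType φ] (U : S.Opens) (hU : IsCompact (U : Set S)) [IsIso (φ ∣_ U)] :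
    ∃ (Q : S.IdealSheafData) (S' : Scheme.{u}) (b : S' ⟶ S),
      (∀ W : S.affineOpens, (Q.ideal W).FG) ∧ (Q.support : Set S) = (U : Set S)ᶜ ∧
      IsBlowup b Q ∧ IsOpenImmersion (blowupStrictTransformMap φ b Q) := by
  /- Step 1: a first blowing up making `S ∖ U` an effective Cartier divisor -/
  obtain ⟨I₀, hI₀fg, hI₀supp⟩ := exists_fg_support_eq_compl U hU
  have hccI₀ : centreCompl I₀ = U :=
    TopologicalSpace.Opens.ext (by change (I₀.support : Set S)ᶜ = U; rw [hI₀supp, compl_compl])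
  subst hccI₀
  obtain ⟨S₀, b₀, hb₀⟩ := exists_isBlowup S I₀
  have hE₀ : IsEffectiveCartier (I₀.comap b₀) := hb₀.isEffectiveCartier
  haveI : IsProper b₀ := IsBlowup.isProper_of_fg hI₀fg hb₀
  haveI : CompactSpace S₀ := QuasiCompact.compactSpace_of_compactSpace b₀
  haveI : QuasiSeparatedSpace S₀ := quasiSeparatedSpace_of_quasiSeparated b₀
  -- the strict transform `φ₀ : X₀ → S₀` of `φ` along `b₀`
  set φ₀ := blowupStrictTransformMap φ b₀ I₀ with hφ₀
  haveI : IsSeparated φ₀ :=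
    inferInstanceAs (IsSeparated (blowupStrictTransformι φ b₀ I₀ ≫ pullback.snd φ b₀))
  haveI : QuasiCompact φ₀ :=
    inferInstanceAs (QuasiCompact (blowupStrictTransformι φ b₀ I₀ ≫ pullback.snd φ b₀))
  haveI : LocallyOfFiniteType φ₀ :=
    inferInstanceAs (LocallyOfFiniteType (blowupStrictTransformι φ b₀ I₀ ≫ pullback.snd φ b₀))
  -- `U₀ = b₀⁻¹ U` is the complement of the exceptional divisor; `φ₀` is an isomorphism over it
  set U₀ : S₀.Opens := b₀ ⁻¹ᵁ centreCompl I₀ with hU₀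
  haveI hiso₀ : IsIso (φ₀ ∣_ U₀) := isIso_blowupStrictTransformMap_morphismRestrict φ b₀ I₀ hE₀
  haveI : IsIso (φ₀ ∣_ centreCompl (I₀.comap b₀)) := by rw [← preimage_centreCompl]; exact hiso₀
  /- Step 2: flatten `φ₀` by a `U₀`-admissible blowing up (birational flattening) -/
  obtain ⟨I₁, S₁, b₁, hI₁fg, hI₁U, hb₁, hflat, hlfp⟩ :=
    exists_isBlowup_flat_lfp_of_isIso φ₀ (I₀.comap b₀) hE₀
  rw [← preimage_centreCompl] at hI₁U
  -- enlarge the centre by the exceptional divisor: `J = I₁ · E₀`, with `V(J) = S₀ ∖ U₀` exactly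
  set J : S₀.IdealSheafData := I₁ * I₀.comap b₀ with hJ
  have hbJ : IsBlowup b₁ J := hb₁.mul_of_isEffectiveCartier hE₀
  have hEJ : IsEffectiveCartier (J.comap b₁) := hbJ.isEffectiveCartier
  have hJfg : ∀ W : S₀.affineOpens, (J.ideal W).FG := fun W => by
    rw [hJ, Scheme.IdealSheafData.ideal_mul, Pi.mul_apply]
    exact (hI₁fg W).mul (hE₀.fg_ideal W)
  have hJsupp : (J.support : Set S₀) = (U₀ : Set S₀)ᶜ := by
    have h1 : ((I₀.comap b₀).support : Set S₀) = (U₀ : Set S₀)ᶜ := by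
      rw [Scheme.IdealSheafData.support_comap, hU₀]
      ext x
      change b₀ x ∈ (I₀.support : Set S) ↔ ¬ (b₀ x ∈ (I₀.support : Set S)ᶜ)
      rw [Set.mem_compl_iff, not_not]
    rw [hJ, Scheme.IdealSheafData.support_mul, TopologicalSpace.Closeds.coe_sup, h1]
    exact Set.union_eq_right.mpr (hI₁U.subset_compl_left)
  have hccJ : centreCompl J = U₀ :=
    TopologicalSpace.Opens.ext (by change (J.support : Set S₀)ᶜ = U₀; rw [hJsupp, compl_compl])
  -- the strict transform `φ₁ : X₁ → S₁` of `φ₀` along `b₁` with respect to `V(J)` is flat …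
  set φ₁ := blowupStrictTransformMap φ₀ b₁ J with hφ₁
  haveI : Flat (blowupStrictTransformMap φ₀ b₁ I₁) := hflat
  haveI : LocallyOfFinitePresentation (blowupStrictTransformMap φ₀ b₁ I₁) := hlfp
  have hsupple : (I₁.support : Set S₀) ⊆ J.support := by
    rw [hJ, Scheme.IdealSheafData.support_mul, TopologicalSpace.Closeds.coe_sup]
    exact Set.subset_union_left
  haveI : Flat φ₁ :=
    flat_blowupStrictTransformMap_of_dominating I₁ J (Category.id_comp b₁) hsupple hEJ
  haveI : LocallyOfFinitePresentation φ₁ :=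
    locallyOfFinitePresentation_blowupStrictTransformMap_of_dominating I₁ J (Category.id_comp b₁)
      hsupple hEJ
  haveI : IsSeparated φ₁ :=
    inferInstanceAs (IsSeparated (blowupStrictTransformι φ₀ b₁ J ≫ pullback.snd φ₀ b₁))
  -- … an isomorphism over `b₁⁻¹ U₀`, with retrocompact schematically dense preimage: an open
  -- immersion (Stacks 081M)
  haveI : IsIso (φ₀ ∣_ centreCompl J) := by rw [hccJ]; exact hiso₀
  haveI : IsIso (φ₁ ∣_ b₁ ⁻¹ᵁ centreCompl J) :=
    isIso_blowupStrictTransformMap_morphismRestrict φ₀ b₁ J hEJ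
  obtain ⟨hqc, hsd⟩ := quasiCompact_and_isSchemeTheoreticallyDominant_ι_preimage φ₀ b₁ J hEJ
  haveI := hqc
  haveI := hsd
  have hopen : IsOpenImmersion φ₁ :=
    Morphisms.isOpenImmersion_of_flat_of_isIso_morphismRestrict φ₁ (b₁ ⁻¹ᵁ centreCompl J)
  /- Step 3: the composite blowing up and the identification of strict transforms -/
  have hU₀disj : Disjoint ((b₀ ⁻¹ᵁ centreCompl I₀ : S₀.Opens) : Set S₀) (J.support : Set S₀) := by
    rw [hJsupp]
    exact disjoint_compl_right
  have hUdisj : Disjoint ((centreCompl I₀ : S.Opens) : Set S) (I₀.support : Set S) :=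
    disjoint_compl_left
  obtain ⟨Q, hQfg, hQU, hbQ⟩ :=
    hb₀.exists_isBlowup_comp_admissible (centreCompl I₀) hI₀fg hUdisj hbJ hJfg hU₀disj
  -- normalise the centre: `Q · I₀` has support exactly `S ∖ U` and the same blowing up
  have hI₀b : IsEffectiveCartier (I₀.comap (b₁ ≫ b₀)) := by
    have h : IsEffectiveCartier ((I₁ * I₀.comap b₀).comap b₁) := hEJ
    rw [comap_mul] at h
    rw [Scheme.IdealSheafData.comap_comp]
    exact h.of_mul_right
  have hbQ' : IsBlowup (b₁ ≫ b₀) (Q * I₀) := hbQ.mul_of_isEffectiveCartier_comap hI₀b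
  have hQsupp : ((Q * I₀).support : Set S) = ((centreCompl I₀ : S.Opens) : Set S)ᶜ := by
    rw [Scheme.IdealSheafData.support_mul, TopologicalSpace.Closeds.coe_sup, hI₀supp]
    exact Set.union_eq_right.mpr hQU.subset_compl_left
  have hccQ : centreCompl (Q * I₀) = centreCompl I₀ :=
    TopologicalSpace.Opens.ext (by
      change ((Q * I₀).support : Set S)ᶜ = (centreCompl I₀ : S.Opens)
      rw [hQsupp, compl_compl])
  refine ⟨Q * I₀, S₁, b₁ ≫ b₀, fun W => ?_, hQsupp, hbQ', ?_⟩
  · rw [Scheme.IdealSheafData.ideal_mul, Pi.mul_apply]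
    exact (hQfg W).mul (hI₀fg W)
  -- transport `hopen` along the identifications of strict transforms
  haveI : QuasiCompact ((pullback.snd φ (b₁ ≫ b₀)) ⁻¹ᵁ ((b₁ ≫ b₀) ⁻¹ᵁ centreCompl (Q * I₀))).ι := by
    rw [preimage_centreCompl]
    exact quasiCompact_ι_preimage_centreCompl _ hbQ'.isEffectiveCartier
  rw [blowupStrictTransformMap_comp_base_iff φ b₀ b₁ J (Q * I₀) @IsOpenImmersion
    (by rw [hccQ, hccJ, Scheme.Hom.comp_preimage])]
  haveI : IsIso (blowupStrictTransformι φ b₀ I₀ ∣_ (pullback.snd φ b₀) ⁻¹ᵁ centreCompl J) := by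
    rw [hccJ]
    exact isIso_blowupStrictTransformι_morphismRestrict φ b₀ I₀ hE₀
  exact (blowupStrictTransformMap_comp_iff_of_isClosedImmersion (blowupStrictTransformι φ b₀ I₀)
    (pullback.snd φ b₀) b₁ J @IsOpenImmersion hEJ).mp hopen

end S081

end Literature.AlgebraicGeometry.Resolution

end
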